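import Summits.AtomisticToContinuum.Crystallization.Theorems.ChargedEnergyGapChartDialK
import HarnessLib

/-!
(SPLIT FOR THE 400-LINE CAP by the landing lane, hand-2 g29: this file = part A; part B = `…ChargedEnergyGapTwinWalls` imports it; same namespace, all FQNs unchanged.)
# `ChargedEnergyGap` — TWIN WALLS: the EXTRACTION beneath (JE), typed at configuration level
# (cell `decomp-a2c`, lens 3, generation 59, node «TwinWalls», part P-G(1/2); SUPPORT beneath (N𝄪) of part P-D
# `…Theorems.ChargedEnergyGapLocalTransfer`; over the LANDED tree only: `…Theorems.ChargedEnergyGapChartDialK`.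
# Part P-G(2/2) `…Theorems.ChargedEnergyGapTwinWallsLink` PROVES the three dictionary pieces of §4 for every `θ ≤ 19/100`.)

WHAT THE CRITIC ASKED (row 1084 (B)): part P-F (`…TwinSector`, g58) proved the junction-exclusion theorem (JE) over
IDEALISED data — a closed face word `w` with `(w.map twinRot).prod` integral and in-plane directions obeying
(COPLANAR)/(CONSECUTIVE); «(N𝄪)'s reduction must PRODUCE that structure from the tree's data — TYPE the EXTRACTION
statement … from the labelled/charted configuration within `ϱ` of a junction line … OR an (INCOH)-class core within
`ϱ/2` … with a must-fail showing it load-bearing; its proof may wait, its statement may not».  THIS FILE TYPES IT, at the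
level where (N𝄪) consumes it — the competitor's own `θ`-charted, `(1/100)`-charge-free matter (`Q.points`; charts
`ChartedAt θ` of part A, bonds `bonds Q` of part K) — and NOT over `IsSeamSystem` (memo g59 §1: a single periodic reference
with stacking seams cannot carry a second-generation twin — its inclined faces are aligned rims — so references are
instance data chosen AFTER the wall complex is read; the wall complex is what is read here).

THE OBSERVATION (memo g59 §2; Hales DSP §1.3 «a uniquely determined plane of reflectional symmetry, containing six of the
twelve points»).  In the link of a close-packed site the four common neighbours of a bond (`ringNumber = 4`,
`Literature…BondGraph`) come in exactly two SHAPES: a CHERRY (one ring member touching two others: vertex figure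
`3.4.4.3`) or a PERFECT MATCHING (`3.4.3.4`).  In the HCP pattern the cherry bonds are EXACTLY the six equatorial ones, in
the FCC pattern there are NONE — certified here by `decide` on the integer models of `Literature…KissingPatterns`
(`cisInt_hcp_iff`, `not_cisInt_fcc`, `card_ringInt_hcp/fcc`).  And the ring of a bond is the SAME finite set read from
either end (`bondRing_comm`).  Hence, once charts are read through the bond graph (the DICTIONARY pieces below), the
matter-side laws the junction analysis needs are one-line consequences of a symmetry:

 (LC) LAYER CONTINUATION `equatorial_symm`: `p` clean with `q` in an equatorial slot of an hcp frame of `p`, `q` clean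
      ⟹ `q` is hcp-framed with `p` in an equatorial slot of `q`.  So a WALL (an equatorial-adjacency class of clean
      hcp-charted sites) is complete relative to the clean region: it ENDS only at a site that is charged or uncharted
      (`not_cleanAt_of_wall_end`) — (E3) of memo g56 §2 in configuration currency: wall rims are gross/priced matter.
 (FU) ONE LAYER PER SITE `inSlot_of_inSlot`: the equatorial slots of a clean site do not depend on the hcp frame
      chosen; with (TE) `not_fccFrame_of_hcpFrame` (a clean site is not both fcc- and hcp-framed) every clean site lies on
      AT MOST ONE wall — (E2): walls do not cross inside clean matter.
 (JX) JUNCTION EXCLUSION AT AN INSPECTED COLUMN `walls_through_clean_site`: all walls through a clean site `c` continue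
      through `c` inside the ONE equatorial layer of `c` — around a clean column the faces pair into one plane, `k ∈ {0, 2}`:
      the conclusion of (JE) `length_eq_two_of_sector` WITHOUT the face word, because the column itself is read.
(JE) (P-F) is thereby placed: it is the `r → 0` idealisation of (JX) and the tool for the ANNULAR case (column not
inspected: closure of the face word by `exists_adjacent_eq_of_prod_mem`), which (N𝄪) does not meet — an uninspectable
column is uncharted, hence GROSS: a core (`w = 0` within `ϱ/2 = 80`, P-D) or other-gross matter (debit zone `R₁`, payer
(β)); the residual matter-side input stays the census ask INCOH-58 (junction/tip/Σ9/fivefold columns of RELAXED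
Lennard-Jones matter are uncharted at `θ = 3/20`).  Why charge-freeness and not charts alone: a stacking slip smeared over
`ζ` sites passes shells `≈ 0.1445`-close to the hcp pattern (linear frames; `< 3/20`!) but its bridge-stacked sites have
coordination `≠ 12` — charged; the clean hypothesis is robust where the charted one is not (memo g59 §3).

THE DICTIONARY (the pieces; pure finite metric geometry of ONE clean shell, no energy, no reference lattice):
 X-D0 `LinkIsomorphism θ`  — under a `θ`-matching of a clean shell to a framed pattern, two shell points are bonded iff
      their pattern images touch (margins at the record `θ = 3/20`: bonded pairs `≤ 1.01² = 1.0201`, non-touching pattern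
      pairs `≥ √2 − 2θ = 1.1142`, in units of `nn(p)`; touching ⟸ counting `24 = 24` link edges of a charge-free site);
 X-D1 `SlotDictionary θ`   — at a clean hcp-framed site the equatorial slots of the frame are exactly the cis bonds;
 X-D2 `FccNoCis θ`         — a clean fcc-framed site has no cis bond.
X-D1/X-D2 are X-D0 transported through the matching plus the two `decide` certificates.  In THIS file the three pieces are
the hypotheses of §5 (so that P-G(1/2) stands over the landed tree alone); part P-G(2/2) PROVES ALL THREE for every
`θ ≤ 19/100` (`linkIsomorphism_of_le`, `slotDictionary_of_le`, `fccNoCis_of_le`, `cleanLinkDictionaryRec_holds`), so at the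
record `θ = 3/20` every law of §5 is an unconditional theorem.  They enter BENEATH (N𝄪) exactly as (T)/(JE) did: (N𝄪)'s
proof cites them; they add no hypothesis to (H𝄪), no datum, no dial; the record
`(ϱχ, Cχ) = (80, 10⁻⁵)`, `(μ₀, τ, λ, b₀, r_S, C_T) = (1/100, 3/100, 1/2, 2/5, 3, 1/(3·10⁶))`, `θ = 3/20` is unchanged.

CONTENTS.  §1 integer certificates (cis ↔ equatorial; ring size 4) · §2 the bond ring and cis bonds of `Q` (symmetric by
`rfl`-level set algebra; `ringNumber = (bondRing).ncard`) · §3 frames, slots, clean sites · §4 the three dictionary pieces ·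
§5 the laws (LC)(FU)(TE)(JX)(E3) PROVED from X-D1 + X-D2 · §6 record abbreviations at `θ = 3/20`.
No `sorry`, no axiom, no instance, no notation, no `set_option`; `decide` only on the closed integer models.
-/

noncomputable section

open Literature.MathematicalPhysics.StatisticalMechanics
open Literature.Geometry.DiscreteGeometry
open Summit.AtomisticToContinuum.Crystallization.Theses.PricedLinkCensus
open Summit.AtomisticToContinuum.Crystallization.Theorems.ChargedEnergyGapNegative

namespace Summit.AtomisticToContinuum.Crystallization.Theorems.ChargedEnergyGapChartDial

section TwinWalls

/-! ## §1 The integer certificates: cherry rings are the equatorial bonds of the HCP pattern, and none of the FCC pattern -/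

/-- The six EQUATORIAL vectors of the integer HCP model `hcpInt` (its mirror plane `x + y + z = 0`; Hales DSP §1.3). -/
def hcpEquatorInt : Finset (Fin 3 → ℤ) :=
  {![3, -3, 0], ![-3, 3, 0], ![3, 0, -3], ![-3, 0, 3], ![0, 3, -3], ![0, -3, 3]}

/-- The equator is part of the model. -/
theorem hcpEquatorInt_subset : hcpEquatorInt ⊆ hcpInt := by decide

/-- Six equatorial vectors. -/
theorem card_hcpEquatorInt : hcpEquatorInt.card = 6 := by decide

/-- CONTACT in an integer model of squared scale `N`: two model vectors touch iff they differ by squared norm `N`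
(after scaling by `1/√N`: distance exactly `1`). -/
abbrev TouchInt (N : ℤ) (v w : Fin 3 → ℤ) : Prop := sqNormInt (v - w) = N

/-- The common-neighbour RING of the centre and the model vector `v`: the model vectors touching `v` (every model vector
touches the centre). -/
abbrev ringInt (S : Finset (Fin 3 → ℤ)) (N : ℤ) (v : Fin 3 → ℤ) : Finset (Fin 3 → ℤ) :=
  S.filter fun w => TouchInt N v w

/-- The bond centre–`v` is CIS in the model `S`: its ring contains a CHERRY — a member touching two other members
(vertex figure `3.4.4.3` at `v`). -/
abbrev CisInt (S : Finset (Fin 3 → ℤ)) (N : ℤ) (v : Fin 3 → ℤ) : Prop :=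
  ∃ a ∈ ringInt S N v, ∃ b ∈ ringInt S N v, ∃ c ∈ ringInt S N v, b ≠ c ∧ TouchInt N a b ∧ TouchInt N a c

/-- ★ CERTIFICATE (HCP): in the anticuboctahedron the cis bonds are EXACTLY the six equatorial ones. -/
theorem cisInt_hcp_iff : ∀ v ∈ hcpInt, (CisInt hcpInt 18 v ↔ v ∈ hcpEquatorInt) := by decide

/-- ★ CERTIFICATE (FCC): in the cuboctahedron NO bond is cis (vertex figure `3.4.3.4` everywhere). -/
theorem not_cisInt_fcc : ∀ v ∈ fccInt, ¬ CisInt fccInt 2 v := by decide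

/-- Ring number four in the HCP model. -/
theorem card_ringInt_hcp : ∀ v ∈ hcpInt, (ringInt hcpInt 18 v).card = 4 := by decide

/-- Ring number four in the FCC model. -/
theorem card_ringInt_fcc : ∀ v ∈ fccInt, (ringInt fccInt 2 v).card = 4 := by decide

/-- The polar (non-equatorial) HCP bonds are not cis — the contrapositive half of `cisInt_hcp_iff`, stated alone. -/
theorem not_cisInt_hcp_polar : ∀ v ∈ hcpInt, v ∉ hcpEquatorInt → ¬ CisInt hcpInt 18 v :=
  fun v hv hne hc => hne ((cisInt_hcp_iff v hv).1 hc)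

/-! ## §2 The bond ring and the cis bonds of a configuration (read in the bond graph alone: no chart, no frame) -/

section ring

variable (Q : PeriodicConfiguration 3)

/-- The common-neighbour RING of `p` and `q` in the `(1/100)`-bond graph of `Q` — the set whose size is the
`ringNumber` of `Literature…BondGraph`. -/
def bondRing (p q : Q.points) : Set Q.points := (bonds Q).neighborSet p ∩ (bonds Q).neighborSet q

/-- The ring number counts the bond ring. -/
theorem ringNumber_eq_ncard_bondRing (p q : Q.points) :
    ringNumber (1 / 100) (Subtype.val : Q.points → E3) p q = (bondRing Q p q).ncard := rfl

/-- ★ The ring is the same set read from either end. -/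
theorem bondRing_comm (p q : Q.points) : bondRing Q p q = bondRing Q q p := Set.inter_comm _ _

/-- Members of the ring are bonded to both ends. -/
theorem adj_of_mem_bondRing {p q a : Q.points} (ha : a ∈ bondRing Q p q) :
    (bonds Q).Adj p a ∧ (bonds Q).Adj q a := ha

/-- At a charge-free site every bond has a ring of exactly four members. -/
theorem ncard_bondRing_eq_four {p q : Q.points} (hp : IsChargeFree (1 / 100) (Subtype.val : Q.points → E3) p)
    (hq : (bonds Q).Adj p q) : (bondRing Q p q).ncard = 4 :=
  hp.ringNumber_eq ((SimpleGraph.mem_neighborSet _ _ _).2 hq)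

/-- **CIS BOND**: `p ∼ q` and the ring of the bond contains a CHERRY (a member bonded to two other members).  The
configuration-level reading of the vertex figure `3.4.4.3`. -/
def IsCisBond (p q : Q.points) : Prop :=
  (bonds Q).Adj p q ∧ ∃ a ∈ bondRing Q p q, ∃ b ∈ bondRing Q p q, ∃ c ∈ bondRing Q p q,
    b ≠ c ∧ (bonds Q).Adj a b ∧ (bonds Q).Adj a c

/-- ★ SYMMETRY: cis is a property of the bond, not of an end. -/
theorem isCisBond_comm {p q : Q.points} : IsCisBond Q p q ↔ IsCisBond Q q p := by
  unfold IsCisBond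
  rw [bondRing_comm Q p q, (bonds Q).adj_comm]

/-- A cis bond is a bond. -/
theorem IsCisBond.adj {p q : Q.points} (h : IsCisBond Q p q) : (bonds Q).Adj p q := h.1

end ring

/-! ## §3 Frames, equatorial slots, clean sites -/

section frames

variable (Q : PeriodicConfiguration 3)

/-- `A` is an **HCP FRAME** of `p` at tolerance `θ`: the own-scale first shell of `p` is a finite set `θ`-matched to
`A(hcp pattern)` (`ChartedAt` of part A with the isometry and the pattern named). -/
def HcpFrame (θ : ℝ) (p : Q.points) (A : E3 →ₗᵢ[ℝ] E3) : Prop :=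
  ∃ T : Finset E3, (↑T : Set E3) = shellSet Q p ∧ EtaMatched θ T (hcpKissingPattern.image A)

/-- `A` is an **FCC FRAME** of `p` at tolerance `θ`. -/
def FccFrame (θ : ℝ) (p : Q.points) (A : E3 →ₗᵢ[ℝ] E3) : Prop :=
  ∃ T : Finset E3, (↑T : Set E3) = shellSet Q p ∧ EtaMatched θ T (fccKissingPattern.image A)

/-- `ChartedAt` is «some fcc frame or some hcp frame». -/
theorem chartedAt_iff_frame {θ : ℝ} {p : Q.points} :
    ChartedAt θ Q p ↔ (∃ A, FccFrame Q θ p A) ∨ (∃ A, HcpFrame Q θ p A) := by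
  constructor
  · rintro ⟨T, hT, ⟨A, hA⟩ | ⟨A, hA⟩⟩
    · exact Or.inl ⟨A, T, hT, hA⟩
    · exact Or.inr ⟨A, T, hT, hA⟩
  · rintro (⟨A, T, hT, hA⟩ | ⟨A, T, hT, hA⟩)
    · exact ⟨T, hT, Or.inl ⟨A, hA⟩⟩
    · exact ⟨T, hT, Or.inr ⟨A, hA⟩⟩

/-- An hcp frame charts the site. -/
theorem chartedAt_of_hcpFrame {θ : ℝ} {p : Q.points} {A : E3 →ₗᵢ[ℝ] E3} (h : HcpFrame Q θ p A) :
    ChartedAt θ Q p :=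
  (chartedAt_iff_frame Q).2 (Or.inr ⟨A, h⟩)

/-- An fcc frame charts the site. -/
theorem chartedAt_of_fccFrame {θ : ℝ} {p : Q.points} {A : E3 →ₗᵢ[ℝ] E3} (h : FccFrame Q θ p A) :
    ChartedAt θ Q p :=
  (chartedAt_iff_frame Q).2 (Or.inl ⟨A, h⟩)

/-- The EQUATORIAL HEXAGON of the HCP pattern (the six pattern points in its mirror plane). -/
def hcpEquator : Finset E3 := scaledPattern hcpEquatorInt 18

/-- The hexagon is part of the pattern. -/
theorem hcpEquator_subset : hcpEquator ⊆ hcpKissingPattern :=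
  Finset.image_subset_image hcpEquatorInt_subset

/-- Six points. -/
theorem card_hcpEquator : hcpEquator.card = 6 := by
  rw [hcpEquator, card_scaledPattern _ (by norm_num), card_hcpEquatorInt]

/-- `q` occupies an **EQUATORIAL SLOT** of the frame `A` at `p`: its shell position is within `θ` of an equatorial
pattern point of `A(hcp pattern)`. -/
def InSlot (θ : ℝ) (p q : Q.points) (A : E3 →ₗᵢ[ℝ] E3) : Prop :=
  ∃ v ∈ hcpEquator, dist (shellCoord Q p q) (A v) ≤ θ

/-- **CO-LAYERED** (`q` after `p`): `q` occupies an equatorial slot of SOME hcp frame of `p`.  The wall relation; its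
symmetry on clean matter is the layer-continuation law (§5). -/
def Equatorial (θ : ℝ) (p q : Q.points) : Prop := ∃ A : E3 →ₗᵢ[ℝ] E3, HcpFrame Q θ p A ∧ InSlot Q θ p q A

/-- **CLEAN** site: `(1/100)`-charge-free and `θ`-charted — the matter through which walls are read.  (Not clean =
charged or uncharted = priced or gross: the species of parts A–K.) -/
def CleanAt (θ : ℝ) (p : Q.points) : Prop :=
  IsChargeFree (1 / 100) (Subtype.val : Q.points → E3) p ∧ ChartedAt θ Q p

/-- A co-layered pair starts at an hcp-charted site. -/
theorem chartedAt_of_equatorial {θ : ℝ} {p q : Q.points} (h : Equatorial Q θ p q) : ChartedAt θ Q p := by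
  obtain ⟨A, hA, -⟩ := h
  exact chartedAt_of_hcpFrame Q hA

/-- Not clean = charged or uncharted. -/
theorem not_cleanAt_iff {θ : ℝ} {p : Q.points} :
    ¬ CleanAt Q θ p ↔ ¬ IsChargeFree (1 / 100) (Subtype.val : Q.points → E3) p ∨ ¬ ChartedAt θ Q p := by
  rw [CleanAt, not_and_or]

end frames

/-! ## §4 The dictionary pieces (pure finite metric geometry of one clean shell) -/

/-- piece X-D0 · SUPPORT · PROVED for `θ ≤ 19/100` in P-G(2/2) (`linkIsomorphism_of_le`; margins: bonded `≤ 1.0201` vs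
non-touching `≥ √2 − 2θ`; at `θ = 3/20`: `1.0201 < 1.1142`) — **LINK ISOMORPHISM at tolerance `θ`**: at a clean site, under any
`θ`-matching of its own-scale shell to a framed kissing pattern, two shell points are bonded in `bonds Q` iff their
pattern images touch (distance `1`).  Source: the matching IS a graph isomorphism link ≅ contact graph (⟹ by the two
margins; ⟸ by counting the `24` link edges of a charge-free site against the `24` contacts). -/
def LinkIsomorphism (θ : ℝ) : Prop :=
  ∀ (Q : PeriodicConfiguration 3) (p : Q.points) (P : Finset E3),
    (P = fccKissingPattern ∨ P = hcpKissingPattern) →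
    ∀ (A : E3 →ₗᵢ[ℝ] E3) (T : Finset E3), (↑T : Set E3) = shellSet Q p →
    ∀ e : ↥T ≃ ↥(P.image A), (∀ t : ↥T, dist (t : E3) (e t : E3) ≤ θ) → CleanAt Q θ p →
    ∀ (q r : Q.points) (hq : shellCoord Q p q ∈ T) (hr : shellCoord Q p r ∈ T),
      ((bonds Q).Adj q r ↔ dist (e ⟨shellCoord Q p q, hq⟩ : E3) (e ⟨shellCoord Q p r, hr⟩ : E3) = 1)

/-- piece X-D1 · SUPPORT · PROVED for `θ ≤ 19/100` in P-G(2/2) (`slotDictionary_of_le`: X-D0 transported through the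
matching + `cisInt_hcp_iff`) — **SLOT DICTIONARY at tolerance `θ`**: at a clean site with an hcp frame, the equatorial slots of the
frame are EXACTLY the cis bonds.  (⟹: the slot point is the match of `q`, `2θ < 1`; the ring of `p q` is the image of the
model ring, a cherry by `cisInt_hcp_iff`.  ⟸: the match of `q` is a model vector whose model ring is a cherry, hence
equatorial.) -/
def SlotDictionary (θ : ℝ) : Prop :=
  ∀ (Q : PeriodicConfiguration 3) (p q : Q.points) (A : E3 →ₗᵢ[ℝ] E3),
    CleanAt Q θ p → HcpFrame Q θ p A → (InSlot Q θ p q A ↔ IsCisBond Q p q)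

/-- piece X-D2 · SUPPORT · PROVED for `θ ≤ 19/100` in P-G(2/2) (`fccNoCis_of_le`: X-D0 + `not_cisInt_fcc`) — **NO CIS
BOND AT AN FCC-FRAMED CLEAN SITE**. -/
def FccNoCis (θ : ℝ) : Prop :=
  ∀ (Q : PeriodicConfiguration 3) (p q : Q.points) (A : E3 →ₗᵢ[ℝ] E3),
    CleanAt Q θ p → FccFrame Q θ p A → ¬ IsCisBond Q p q

end TwinWalls

end Summit.AtomisticToContinuum.Crystallization.Theorems.ChargedEnergyGapChartDial
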